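/- EXTRA WIDTH seat `ym-line-cbag-p1-w5` (prover-ym-line-cbag-p1-w5-g12-0), LINE 7 `GlueballBandRecursion`, in support of
⟨stmt-QuantumFields-22957⟩ `OneParticleBlochSymbolFamily` (= `Band.EffectiveBlochSymbolFamily`): the VOLUME-STABILITY clause of the
LEAD's one open stub `IsolatedBandFrame` (`…IsolatedBandDefs`: `∃ ℓ, ∀ N ≥ L₀, … |log(μ_max/λ₊) − ℓ| ≤ D'/N`) reduced to PAIRWISE
finite-volume closeness — no infinite-volume object is needed.  Route-independent; definition-free; a helper. -/
import Summits.QuantumFields.YangMills.Theorems.GlueballBandRecursionIsolatedBandDefs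
import Summits.QuantumFields.YangMills.Theorems.GlueballBandRecursionSymbolSupremum

/-!
# Route `GlueballBandRecursion`, item `OneParticleBlochSymbolFamily` (stmt-QuantumFields-22957): the `N`-independent log-rate from
# pairwise two-volume closeness (the Cauchy route), and the two-volume comparison of torus symbols

The item and the LEAD's stub `IsolatedBandFrame` ask for ONE number `ℓ = ℓ(β)` with `|log Λ_N − ℓ| ≤ D'/N` (resp.
`|log(μ_max(N)/λ₊(N)) − ℓ| ≤ D'/N`) for ALL spatial periods `N ≥ L₀` — in print (`Schor 1984`) `ℓ` is the infinite-volume glueball mass,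
an object the tree does not have.  THIS FILE shows that no infinite-volume object is needed:

* §1 `exists_limit_of_pairwise_abs_sub_le` (pure real analysis): if `|x_N − x_{N'}| ≤ D/N` for all `L₀ ≤ N ≤ N'`, then `x` converges and
  its limit `ℓ` satisfies `|x_N − ℓ| ≤ D/N` for every `N ≥ L₀` — VERBATIM the shape of the clause (`exists_logRate_of_pairwise` for
  `x_N = log(top_N)`; `exists_logRate_of_sup_pairwise` the turnkey form through the symbol suprema).  So the cluster expansion owes
  only a PAIRWISE comparison of two finite tori.
* §2 the two-volume comparison of the symmetrised torus symbols `B̃_J = kernelSymbol J` (`…TransferSymbol`) of kernels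
  `J : (ℤ/N)³ → Mat_n(ℝ)`, `J' : (ℤ/N')³ → Mat_n(ℝ)`, `N ≤ N'`: along any map `lift : (ℤ/N)³ → (ℤ/N')³` preserving the centred
  representatives (`valMinAbs_intCast_valMinAbs`: `z ↦ (z̃ mod N')` is one), the phases agree (`sitePhase_eq_of_valMinAbs_eq`), `lift` is
  injective, and for every unit `u` and every `q ∈ ℝ³` (`abs_re_inner_kernelSymbol_sub_le`)
  `|Re⟪u, B̃_J(q)u⟫ − Re⟪u, B̃_{J'}(q)u⟫| ≤ Σ_z ‖J z − J'(lift z)‖₁ + Σ_{z' ∉ image} ‖J' z'‖₁` (`‖·‖₁ = entryNorm`),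
  where the sites off the image have `N ≤ 2·siteSize z'` (`le_two_mul_siteSize_of_not_mem_image`) — the BULK term (clusters not
  wrapping the `N`-torus agree in both volumes) and the FAR TAIL of the larger kernel (kernel decay), both exponentially small in `N` for a
  cluster-expansion kernel;
* §3 `abs_log_sup_kernelSymbol_sub_le`: with (P1)-floors `r₀` at both volumes, the attained suprema `Λ, Λ'` of the two symbols satisfy
  `|log Λ − log Λ'| ≤ (Σ_z ‖J z − J'(lift z)‖₁ + Σ_{z' ∉ image} ‖J' z'‖₁)/r₀` (`Symbol.abs_log_sup_sub_log_sup_le`); combined with the LEAD's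
  `abs_log_sup_sub_log_bandTop_le` (`|log Λ_N − log μ_max/λ₊| ≤ 12π²K/N²`, `…SymbolBandTop`) and §1 this yields the clause.

Sources: folklore (Cauchy sequences; finite trigonometric sums).

HONEST FRAMING.  Real analysis and torus bookkeeping for the conditional skeleton of the XL item 22957 (strong-coupling RECORD-rung line);
the stub `IsolatedBandFrame`, the item, the rung `ColdDoublingRecursionStrongCoupling` and — a fortiori — the Yang–Mills mass gap / the summit
`YangMills` are NOT proved or advanced here.
-/

set_option autoImplicit false

noncomputable section

open scoped InnerProductSpace BigOperators Matrix
open Finset Filter Topology Complex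
open Literature.MathematicalPhysics.QuantumFieldTheory

namespace Summit.QuantumFields.YangMills.Theorems.GlueballBandRecursion.Band

/-! ### §1 The Cauchy route to an `N`-independent log-rate -/

/-- **Pairwise `D/N`-closeness gives a limit with the same rate.**  If `|x_N − x_{N'}| ≤ D/N` whenever `L₀ ≤ N ≤ N'`, then `x`
converges to some `ℓ` and `|x_N − ℓ| ≤ D/N` for every `N ≥ L₀` (Cauchy criterion; the bound passes to the limit in `N'`). [folklore] -/
theorem exists_limit_of_pairwise_abs_sub_le {x : ℕ → ℝ} {D : ℝ} {L₀ : ℕ}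
    (h : ∀ N N' : ℕ, L₀ ≤ N → N ≤ N' → |x N - x N'| ≤ D / N) :
    ∃ ℓ : ℝ, Tendsto x atTop (𝓝 ℓ) ∧ ∀ N : ℕ, L₀ ≤ N → |x N - ℓ| ≤ D / N := by
  -- shift past `L₀` and `0`
  set L₁ : ℕ := max L₀ 1 with hL₁
  have hL₀₁ : L₀ ≤ L₁ := le_max_left _ _
  have h1 : 1 ≤ L₁ := le_max_right _ _
  have hD : 0 ≤ D := by
    have h0 := h L₁ L₁ hL₀₁ le_rfl
    rw [sub_self, abs_zero] at h0
    have hL : (0 : ℝ) < L₁ := by exact_mod_cast h1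
    exact (div_nonneg_iff.1 h0).elim (fun h' => h'.1) fun h' => absurd h'.2 (not_le.2 hL)
  set y : ℕ → ℝ := fun k => x (k + L₁) with hy_def
  have hy : CauchySeq y := by
    refine cauchySeq_of_le_tendsto_0 (fun K : ℕ => D / ((K + L₁ : ℕ) : ℝ)) (fun k k' K hk hk' => ?_) ?_
    · have hK : (0 : ℝ) < ((K + L₁ : ℕ) : ℝ) := by exact_mod_cast (by omega : 0 < K + L₁)
      rw [Real.dist_eq]
      rcases le_total k k' with hkk | hkk
      · calc |x (k + L₁) - x (k' + L₁)| ≤ D / ((k + L₁ : ℕ) : ℝ) := h _ _ (by omega) (by omega)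
          _ ≤ D / ((K + L₁ : ℕ) : ℝ) :=
            div_le_div_of_nonneg_left hD hK (by exact_mod_cast (by omega : K + L₁ ≤ k + L₁))
      · rw [abs_sub_comm]
        calc |x (k' + L₁) - x (k + L₁)| ≤ D / ((k' + L₁ : ℕ) : ℝ) := h _ _ (by omega) (by omega)
          _ ≤ D / ((K + L₁ : ℕ) : ℝ) :=
            div_le_div_of_nonneg_left hD hK (by exact_mod_cast (by omega : K + L₁ ≤ k' + L₁))
    · have ht := (tendsto_const_div_atTop_nhds_zero_nat D).comp (tendsto_add_atTop_nat L₁)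
      exact ht
  obtain ⟨ℓ, hℓ⟩ := cauchySeq_tendsto_of_complete hy
  have hx : Tendsto x atTop (𝓝 ℓ) := (tendsto_add_atTop_iff_nat L₁).1 hℓ
  refine ⟨ℓ, hx, fun N hN => ?_⟩
  have hlim : Tendsto (fun k => |x N - y k|) atTop (𝓝 |x N - ℓ|) := (tendsto_const_nhds.sub hℓ).abs
  refine le_of_tendsto hlim ?_
  filter_upwards [eventually_ge_atTop N] with k hk
  exact h N (k + L₁) hN (by omega)

/-- **The log-rate `ℓ` from pairwise closeness** — the shape of the volume-stability clauses of `Band.IsolatedBandFrame` /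
`Band.EffectiveBlochSymbolFamily`: if the band tops (or symbol suprema) `top_N` of the tori `N ≥ L₀` satisfy
`|log top_N − log top_{N'}| ≤ D/N` for `L₀ ≤ N ≤ N'`, then `∃ ℓ, ∀ N ≥ L₀, |log top_N − ℓ| ≤ D/N`. [folklore] -/
theorem exists_logRate_of_pairwise {top : ℕ → ℝ} {D : ℝ} {L₀ : ℕ}
    (h : ∀ N N' : ℕ, L₀ ≤ N → N ≤ N' → |Real.log (top N) - Real.log (top N')| ≤ D / N) :
    ∃ ℓ : ℝ, ∀ N : ℕ, L₀ ≤ N → |Real.log (top N) - ℓ| ≤ D / N := by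
  obtain ⟨ℓ, -, hℓ⟩ := exists_limit_of_pairwise_abs_sub_le (x := fun N => Real.log (top N)) h
  exact ⟨ℓ, hℓ⟩

/-- **The Cauchy route, turnkey.**  Per-volume proximity of the band top to the symbol supremum (`|log Λ_N − log top_N| ≤ C/N²`,
the LEAD's `abs_log_sup_sub_log_bandTop_le` with `C = 12π²K`) and PAIRWISE two-volume stability of the suprema
(`|log Λ_N − log Λ_{N'}| ≤ D₁/N` for `L₀ ≤ N ≤ N'`, §3 below from kernel closeness) give the volume-stability clause for the band tops:
`∃ ℓ, ∀ N ≥ L₀, |log top_N − ℓ| ≤ (D₁ + 2C)/N` (`L₀ ≥ 1`). [folklore] -/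
theorem exists_logRate_of_sup_pairwise {top sup : ℕ → ℝ} {C D₁ : ℝ} {L₀ : ℕ} (hL₀ : 1 ≤ L₀) (hC : 0 ≤ C)
    (hnear : ∀ N : ℕ, L₀ ≤ N → |Real.log (sup N) - Real.log (top N)| ≤ C / (N : ℝ) ^ 2)
    (hpair : ∀ N N' : ℕ, L₀ ≤ N → N ≤ N' → |Real.log (sup N) - Real.log (sup N')| ≤ D₁ / N) :
    ∃ ℓ : ℝ, ∀ N : ℕ, L₀ ≤ N → |Real.log (top N) - ℓ| ≤ (D₁ + 2 * C) / N := by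
  refine exists_logRate_of_pairwise fun N N' hN hNN' => ?_
  have hN1 : (1 : ℝ) ≤ N := by exact_mod_cast hL₀.trans hN
  have hN0 : (0 : ℝ) < N := by linarith
  have hN'1 : (N : ℝ) ≤ N' := by exact_mod_cast hNN'
  -- `C/N² ≤ C/N` and `C/N'² ≤ C/N`
  have hsq : C / (N : ℝ) ^ 2 ≤ C / N := div_le_div_of_nonneg_left hC hN0 (by nlinarith)
  have hsq' : C / (N' : ℝ) ^ 2 ≤ C / N := div_le_div_of_nonneg_left hC hN0 (by nlinarith)
  have h1 := hnear N hN
  have h2 := hpair N N' hN hNN'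
  have h3 := hnear N' (hN.trans hNN')
  have htri : |Real.log (top N) - Real.log (top N')| ≤
      |Real.log (sup N) - Real.log (top N)| + |Real.log (sup N) - Real.log (sup N')| +
        |Real.log (sup N') - Real.log (top N')| := by
    have e : Real.log (top N) - Real.log (top N') =
        -(Real.log (sup N) - Real.log (top N)) + (Real.log (sup N) - Real.log (sup N')) +
          (Real.log (sup N') - Real.log (top N')) := by ring
    rw [e]
    refine (abs_add_le _ _).trans (add_le_add ((abs_add_le _ _).trans (add_le_add (le_of_eq (abs_neg _)) le_rfl)) le_rfl)
  calc |Real.log (top N) - Real.log (top N')| ≤ C / N + D₁ / N + C / N := by linarith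
    _ = (D₁ + 2 * C) / N := by ring

/-! ### §2 Two volumes: lifting sites along the centred representative, and the comparison of the symbols -/

section TwoVolumes

variable {N N' : ℕ} {n : ℕ}

/-- **Casting a centred representative into a larger modulus keeps it centred**: for `N ≤ N'` and `a ∈ ℤ/N`,
`valMinAbs ((ã : ℤ) : ℤ/N') = ã` (`ã = valMinAbs a ∈ (−N/2, N/2] ⊆ (−N'/2, N'/2]`).  Hence `z ↦ (μ ↦ (z̃_μ : ℤ/N'))` lifts
`(ℤ/N)³` into `(ℤ/N')³` preserving centred representatives. -/
theorem valMinAbs_intCast_valMinAbs [NeZero N] [NeZero N'] (hNN' : N ≤ N') (a : ZMod N) :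
    (((a.valMinAbs : ℤ) : ZMod N')).valMinAbs = a.valMinAbs := by
  rw [ZMod.valMinAbs_spec]
  refine ⟨rfl, ?_, ?_⟩
  · have h1 := a.valMinAbs_mem_Ioc.1
    have h2 : (N : ℤ) ≤ N' := by exact_mod_cast hNN'
    linarith
  · exact a.valMinAbs_mem_Ioc.2.trans (by exact_mod_cast hNN')

/-- Phases only see centred representatives: if `z̃' = z̃` coordinatewise then `sitePhase q z' = sitePhase q z`. -/
theorem sitePhase_eq_of_valMinAbs_eq (q : Fin 3 → ℝ) {z : Site 3 N} {z' : Site 3 N'}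
    (h : ∀ μ, (z' μ).valMinAbs = (z μ).valMinAbs) : sitePhase q z' = sitePhase q z := by
  unfold sitePhase
  simp_rw [h]

/-- The centred phase has modulus one. -/
theorem norm_sitePhase (q : Fin 3 → ℝ) (z : Site 3 N) : ‖sitePhase q z‖ = 1 := by
  rw [sitePhase, mul_comm, Complex.norm_exp_ofReal_mul_I]

/-- A lift preserving centred representatives is injective (`valMinAbs` is injective). -/
theorem injective_of_valMinAbs_eq (lift : Site 3 N → Site 3 N')
    (hlift : ∀ z μ, (lift z μ).valMinAbs = (z μ).valMinAbs) : Function.Injective lift := by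
  intro z₁ z₂ h
  funext μ
  apply ZMod.injective_valMinAbs
  rw [← hlift z₁ μ, ← hlift z₂ μ, h]

/-- **Sites off the image of the lift are far**: if `lift` preserves centred representatives and `z' ∈ (ℤ/N')³` is not of the form
`lift z`, some coordinate of `z̃'` lies outside `(−N/2, N/2]`, so `N ≤ 2·siteSize z'` (where kernel decay makes `J' z'` small). -/
theorem le_two_mul_siteSize_of_not_mem_image [NeZero N] [NeZero N'] (lift : Site 3 N → Site 3 N')
    (hlift : ∀ z μ, (lift z μ).valMinAbs = (z μ).valMinAbs) {z' : Site 3 N'}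
    (hz' : z' ∉ Finset.univ.image lift) : N ≤ 2 * siteSize z' := by
  classical
  -- if every coordinate of `z̃'` were in `(−N/2, N/2]`, `z'` would be the lift of `z = (z̃' mod N)`
  by_contra hlt
  have hlt' : 2 * siteSize z' < N := lt_of_not_ge hlt
  apply hz'
  rw [Finset.mem_image]
  refine ⟨fun μ => (((z' μ).valMinAbs : ℤ) : ZMod N), Finset.mem_univ _, ?_⟩
  -- each coordinate: `|z̃'_μ| ≤ siteSize z' < N/2`
  have hcoord : ∀ μ : Fin 3, ((((z' μ).valMinAbs : ℤ) : ZMod N)).valMinAbs = (z' μ).valMinAbs := by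
    intro μ
    rw [ZMod.valMinAbs_spec]
    refine ⟨rfl, ?_⟩
    have hμ : ((z' μ).valMinAbs).natAbs ≤ siteSize z' :=
      Finset.single_le_sum (f := fun ν : Fin 3 => ((z' ν).valMinAbs).natAbs) (fun ν _ => Nat.zero_le _) (Finset.mem_univ μ)
    have h2 : 2 * ((z' μ).valMinAbs).natAbs < N := lt_of_le_of_lt (Nat.mul_le_mul_left 2 hμ) hlt'
    have h3 : 2 * |(z' μ).valMinAbs| < (N : ℤ) := by
      have : ((2 * ((z' μ).valMinAbs).natAbs : ℕ) : ℤ) < (N : ℤ) := by exact_mod_cast h2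
      simpa [Int.natCast_natAbs] using this
    constructor
    · linarith [neg_abs_le ((z' μ).valMinAbs)]
    · linarith [le_abs_self ((z' μ).valMinAbs)]
  funext μ
  apply ZMod.injective_valMinAbs
  rw [hlift]
  exact hcoord μ

/-- **Entrywise majorant**: `‖⟪u, A_ℂ u⟫‖ ≤ entryNorm A = Σ_{jk} |A_{jk}|` for a unit vector `u` and a real square matrix `A`. -/
theorem norm_inner_map_ofReal_le_entryNorm (A : Matrix (Fin n) (Fin n) ℝ) (u : EuclideanSpace ℂ (Fin n)) (hu : ‖u‖ = 1) :
    ‖⟪u, Matrix.toEuclideanLin (A.map Complex.ofReal) u⟫_ℂ‖ ≤ entryNorm A := by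
  refine (Symbol.norm_inner_toEuclideanLin_le _ u hu).trans (le_of_eq ?_)
  simp only [Matrix.map_apply, Complex.norm_real, Real.norm_eq_abs, entryNorm]

variable [NeZero N] [NeZero N']

/-- **Two-volume comparison of the Rayleigh quotients of the symmetrised torus symbols.**  For kernels `J` on `(ℤ/N)³` and `J'` on
`(ℤ/N')³` and a lift `(ℤ/N)³ → (ℤ/N')³` preserving centred representatives, for every unit `u` and every `q ∈ ℝ³`:
`|Re⟪u, B̃_J(q)u⟫ − Re⟪u, B̃_{J'}(q)u⟫| ≤ Σ_z ‖J z − J'(lift z)‖₁ + Σ_{z' ∉ image lift} ‖J' z'‖₁` (`‖·‖₁ = entryNorm`):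
the bulk discrepancy plus the far tail of the larger kernel. [folklore] -/
theorem abs_re_inner_kernelSymbol_sub_le (J : Site 3 N → Matrix (Fin n) (Fin n) ℝ) (J' : Site 3 N' → Matrix (Fin n) (Fin n) ℝ)
    (lift : Site 3 N → Site 3 N') (hlift : ∀ z μ, (lift z μ).valMinAbs = (z μ).valMinAbs)
    (u : EuclideanSpace ℂ (Fin n)) (hu : ‖u‖ = 1) (q : Fin 3 → ℝ) :
    |RCLike.re ⟪u, Matrix.toEuclideanLin (kernelSymbol J q) u⟫_ℂ -
        RCLike.re ⟪u, Matrix.toEuclideanLin (kernelSymbol J' q) u⟫_ℂ| ≤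
      ∑ z, entryNorm (J z - J' (lift z)) + ∑ z' ∈ (Finset.univ.image lift)ᶜ, entryNorm (J' z') := by
  classical
  have hinj := injective_of_valMinAbs_eq lift hlift
  -- abbreviations for the scalar coefficients
  set c : Site 3 N → ℂ := fun z => ⟪u, Matrix.toEuclideanLin ((J z).map Complex.ofReal) u⟫_ℂ with hc
  set c' : Site 3 N' → ℂ := fun z' => ⟪u, Matrix.toEuclideanLin ((J' z').map Complex.ofReal) u⟫_ℂ with hc'
  rw [re_inner_kernelSymbol, re_inner_kernelSymbol, re_inner_kernelTrigSum, re_inner_kernelTrigSum]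
  -- split the `N'`-sum into the image of the lift and its complement
  have hsplit : ∑ z', RCLike.re (sitePhase q z' * c' z') =
      ∑ z, RCLike.re (sitePhase q z * c' (lift z)) + ∑ z' ∈ (Finset.univ.image lift)ᶜ, RCLike.re (sitePhase q z' * c' z') := by
    rw [← Finset.sum_add_sum_compl (Finset.univ.image lift), Finset.sum_image fun z₁ _ z₂ _ h => hinj h]
    congr 1
    exact Finset.sum_congr rfl fun z _ => by rw [sitePhase_eq_of_valMinAbs_eq q (hlift z)]
  change |∑ z, RCLike.re (sitePhase q z * c z) - ∑ z', RCLike.re (sitePhase q z' * c' z')| ≤ _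
  rw [hsplit, ← sub_sub, ← Finset.sum_sub_distrib]
  -- termwise bounds
  have hbulk : ∀ z, |RCLike.re (sitePhase q z * c z) - RCLike.re (sitePhase q z * c' (lift z))| ≤ entryNorm (J z - J' (lift z)) := by
    intro z
    have hdiff : sitePhase q z * c z - sitePhase q z * c' (lift z) =
        sitePhase q z * ⟪u, Matrix.toEuclideanLin ((J z - J' (lift z)).map Complex.ofReal) u⟫_ℂ := by
      rw [← mul_sub, hc, hc', Matrix.map_sub _ Complex.ofReal_sub, map_sub, LinearMap.sub_apply, inner_sub_right]
    rw [← map_sub, hdiff]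
    refine (RCLike.abs_re_le_norm _).trans ?_
    rw [norm_mul, norm_sitePhase, one_mul]
    exact norm_inner_map_ofReal_le_entryNorm _ u hu
  have htail : ∀ z', |RCLike.re (sitePhase q z' * c' z')| ≤ entryNorm (J' z') := by
    intro z'
    refine (RCLike.abs_re_le_norm _).trans ?_
    rw [norm_mul, norm_sitePhase, one_mul]
    exact norm_inner_map_ofReal_le_entryNorm _ u hu
  calc |∑ z, (RCLike.re (sitePhase q z * c z) - RCLike.re (sitePhase q z * c' (lift z))) -
          ∑ z' ∈ (Finset.univ.image lift)ᶜ, RCLike.re (sitePhase q z' * c' z')|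
      ≤ |∑ z, (RCLike.re (sitePhase q z * c z) - RCLike.re (sitePhase q z * c' (lift z)))| +
          |∑ z' ∈ (Finset.univ.image lift)ᶜ, RCLike.re (sitePhase q z' * c' z')| := abs_sub _ _
    _ ≤ ∑ z, |RCLike.re (sitePhase q z * c z) - RCLike.re (sitePhase q z * c' (lift z))| +
          ∑ z' ∈ (Finset.univ.image lift)ᶜ, |RCLike.re (sitePhase q z' * c' z')| :=
        add_le_add (Finset.abs_sum_le_sum_abs _ _) (Finset.abs_sum_le_sum_abs _ _)
    _ ≤ ∑ z, entryNorm (J z - J' (lift z)) + ∑ z' ∈ (Finset.univ.image lift)ᶜ, entryNorm (J' z') :=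
        add_le_add (Finset.sum_le_sum fun z _ => hbulk z) (Finset.sum_le_sum fun z' _ => htail z')

/-! ### §3 The suprema of two volumes are close -/

/-- **Two-volume stability of `log Λ`.**  If the unit Rayleigh quotients of `B̃_J` and `B̃_{J'}` are `≥ r₀ > 0` ((P1) floors) and
`Λ = R_{us}(qs)`, `Λ' = R_{us'}(qs')` dominate all unit Rayleigh quotients of the respective symbols (the attained suprema of clause (P3)),
then `|log Λ − log Λ'| ≤ (Σ_z ‖J z − J'(lift z)‖₁ + Σ_{z' ∉ image lift} ‖J' z'‖₁)/r₀`. [folklore] -/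
theorem abs_log_sup_kernelSymbol_sub_le (J : Site 3 N → Matrix (Fin n) (Fin n) ℝ) (J' : Site 3 N' → Matrix (Fin n) (Fin n) ℝ)
    (lift : Site 3 N → Site 3 N') (hlift : ∀ z μ, (lift z μ).valMinAbs = (z μ).valMinAbs) {r₀ Λ Λ' : ℝ} (hr₀ : 0 < r₀)
    (hpos : ∀ (q : Fin 3 → ℝ) (u : EuclideanSpace ℂ (Fin n)), ‖u‖ = 1 →
      r₀ ≤ RCLike.re ⟪u, Matrix.toEuclideanLin (kernelSymbol J q) u⟫_ℂ)
    (hpos' : ∀ (q : Fin 3 → ℝ) (u : EuclideanSpace ℂ (Fin n)), ‖u‖ = 1 →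
      r₀ ≤ RCLike.re ⟪u, Matrix.toEuclideanLin (kernelSymbol J' q) u⟫_ℂ)
    (hΛ : ∃ (qs : Fin 3 → ℝ) (us : EuclideanSpace ℂ (Fin n)), ‖us‖ = 1 ∧
      RCLike.re ⟪us, Matrix.toEuclideanLin (kernelSymbol J qs) us⟫_ℂ = Λ)
    (hle : ∀ (q : Fin 3 → ℝ) (u : EuclideanSpace ℂ (Fin n)), ‖u‖ = 1 →
      RCLike.re ⟪u, Matrix.toEuclideanLin (kernelSymbol J q) u⟫_ℂ ≤ Λ)
    (hΛ' : ∃ (qs : Fin 3 → ℝ) (us : EuclideanSpace ℂ (Fin n)), ‖us‖ = 1 ∧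
      RCLike.re ⟪us, Matrix.toEuclideanLin (kernelSymbol J' qs) us⟫_ℂ = Λ')
    (hle' : ∀ (q : Fin 3 → ℝ) (u : EuclideanSpace ℂ (Fin n)), ‖u‖ = 1 →
      RCLike.re ⟪u, Matrix.toEuclideanLin (kernelSymbol J' q) u⟫_ℂ ≤ Λ') :
    |Real.log Λ - Real.log Λ'| ≤
      (∑ z, entryNorm (J z - J' (lift z)) + ∑ z' ∈ (Finset.univ.image lift)ᶜ, entryNorm (J' z')) / r₀ :=
  Symbol.abs_log_sup_sub_log_sup_le hr₀ hΛ hle hΛ' hle' hpos hpos'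
    fun q u hu => abs_re_inner_kernelSymbol_sub_le J J' lift hlift u hu q

end TwoVolumes

end Summit.QuantumFields.YangMills.Theorems.GlueballBandRecursion.Band

end
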